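import Literature.Analysis.FluidPDE.LeiZhang2011RegularityCase1U
import Literature.Analysis.FluidPDE.LeiZhang2011RegularityLerayHopf
import Literature.Analysis.FluidPDE.LeiZhang2011RegularitySmoothDatum
import Literature.Analysis.FluidPDE.NSBoundedMildOseenClassical
import HarnessLib

/-!
# Lei–Zhang 2011, Theorem 1.4: the swirl step in its uniform (Theorem 1.1) form, and the
# reduction of the named fact to Theorem 1.1

Analysis/FluidPDE **proofs file** (theorems only: no definitions, no named facts, no `sorry`)
closing the bookkeeping of the discharge path of
`Literature.Analysis.FluidPDE.LeiZhang2011_regularity_bmoStream` (Z. Lei, Q. S. Zhang,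
J. Funct. Anal. 261 (2011) = arXiv:1011.5066, **Theorem 1.4**). The conditional theorems of
`LeiZhang2011RegularityOfSwirlStep`, `LeiZhang2011RegularityLerayHopf` and
`LeiZhang2011RegularitySmoothDatum` assumed the *swirl step* for blow-up limits whose stream
functions are in `BMO` at each time; Theorem 1.1 of the paper (class `E`,
`‖b‖_E = sup_t ‖B(t)‖_BMO + sup r|b₃|`, (1.2)–(1.3) p. 3) supplies it only for streams bounded in
`BMO` **uniformly in time** — which the blow-up limit does satisfy
(`exists_bmoStream_of_tendstoUniformlyOn`, bound `6K`; `case1_falseU`). This file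

* re-proves the three layers verbatim with the uniform swirl step (`…U` names):
  `LeiZhang2011_regularity_classical_of_swirlStepU`, `…_classical_datum_of_swirlStepU`,
  `…_hasSmoothExtensionPast_of_swirlStepU` (classical frame);
  `ae_bound_near_of_isH1RegularOn_of_swirlStepU`, `LeiZhang2011_regularity_lerayHopf_of_swirlStepU`,
  `LeiZhang2011_regularity_bmoStream_of_swirlStepU_of_swirlBound` (Leray–Hopf frame);
  `LeiZhang2011_regularity_smoothDatum_of_swirlStepU`,
  `LeiZhang2011_regularity_bmoStream_smoothDatum_of_swirlStepU` (smooth data);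
* proves **Theorem 1.1 ⇒ the swirl step** (`swirlStepU_of_holderAtAxis`: the first lines of the
  proof of Theorem 1.2, p. 12 — "letting `L → ∞` … `Γ(x, t) = Γ(0, 0)`", and `Γ = 0` on the
  axis), with Theorem 1.1 taken in the form it is used: a Hölder modulus of `Γ` at the points of
  the axis, at every scale `L`, constants depending only on `(sup |Γ|, sup_t ‖B(t)‖_BMO)`, for
  bounded continuous weak ancient axisymmetric solutions (hypothesis `hHolder`);
* derives **the named fact from Theorem 1.1 and the maximum principle for `Γ` along the weak
  solution** (`LeiZhang2011_regularity_bmoStream_of_holderAtAxis_of_weakMaxPrinciple`; the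
  second hypothesis is the sentence "By the assumption on initial value and the maximum
  principle" of the printed proof, p. 12, for the suitable Leray–Hopf solutions of the statement
  — proved in the tree for classical solutions only, `abs_swirl_le_of_classical`), and, **for
  smooth data, from Theorem 1.1 alone**
  (`LeiZhang2011_regularity_bmoStream_smoothDatum_of_holderAtAxis`).

## References

* Z. Lei, Q. S. Zhang, J. Funct. Anal. 261 (2011) = arXiv:1011.5066: Thm. 1.1 and (1.2)–(1.3)
  (p. 3), proof of Thm. 1.2 (p. 12, first lines), Thm. 1.4, Rem. 1.5 and proof §4 (pp. 4, 12–13).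
  [LeiZhang2011]
* G. Koch, N. Nadirashvili, G. Seregin, V. Šverák, Acta Math. 203 (2009), §6.
  [KochNadirashviliSereginSverak2009]
* J. C. Robinson, J. L. Rodrigo, W. Sadowski, CUP (2016), §8.1, Thms. 8.14, 8.17.
  [RobinsonRodrigoSadowski2016]
* T. Tao, Anal. PDE 6 (2013), Thm. 5.4. [Tao2011]
-/

noncomputable section

open MeasureTheory Set Function Filter Topology TopologicalSpace Metric
open scoped InnerProductSpace RealInnerProductSpace NNReal

namespace Literature.Analysis.FluidPDE

open Literature.Analysis.FunctionSpaces SereginSverak2009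

/-! ## The classical frame -/

section Classical

/-- **Lei–Zhang 2011, Theorem 1.4 (classical frame), conditional on the swirl step.** Let
`(u, p)` be a classical solution of the unforced Navier–Stokes system (`ν = 1`) on
`(0, T) × ℝ³`, bounded on every `(0, T') × ℝ³`, `T' < T`, with axisymmetric slices,
`|Γ| = |r u^θ| ≤ C₁` on `(0, T) × ℝ³`, and a stream function with `BMO` slices,
`sup_t ‖B(t)‖_BMO ≤ K` (`HasBMOStreamFunctionOn`). Assume the **swirl step** `hstep` (the content
of Theorem 1.1 of the paper as used in the proof of Theorem 1.4, Case 1: a continuous bounded weak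
ancient axisymmetric solution with bounded `Γ` and distributional `L^∞_t BMO_x` stream function is
swirl free). Then `u` is bounded on `(0, T) × ℝ³`. Printed proof (arXiv:1011.5066 pp. 12–13):
by contradiction, near-maxima `(t_k, x_k)` with `Q_k = |v(t_k, x_k)| → ∞`, rescaling (1.6),
and the dichotomy `r_k Q_k` bounded (Case 1: zoom on the axis, limit axisymmetric ancient,
swirl free by Theorem 1.1, zero by [KNSS] Thm. 5.2 and the `BMO⁻¹` bound — `case1_false`) or
`r_k Q_k → ∞` (Case 2: zoom at `x_k`, limit planar, constant by [KNSS] Thm. 5.1, zero by the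
`BMO⁻¹` bound — `case2_false`); either way `|u(0, ·)| = 1` somewhere, a contradiction. The
near-maximum selection and the normalisations `t_k Q_k² ≥ 2`, `t_k Q_k² → ∞` are those of
`KNSS2009_regularity_bound_C_over_r_one`; `x_k` is rotated onto the meridian half-plane by
axisymmetry (`exists_meridian_point_norm_eq`). [cite: LeiZhang2011, Thm. 1.4 and its proof §4 (arXiv pp. 12–13)] -/
theorem LeiZhang2011_regularity_classical_of_swirlStepU
    (hstep : ∀ (v : ℝ → EuclideanSpace ℝ (Fin 3) → EuclideanSpace ℝ (Fin 3)) (C : ℝ)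
      (K' : ℝ≥0),
      IsBoundedWeakNSSolutionOn (Iio 0) isOpen_Iio 1 v → Continuous (uncurry v) →
      (∀ t < 0, IsAxisymmetric (v t)) → (∀ t < 0, ∀ x, |swirl (v t) x| ≤ C) →
      (∀ t < 0, ∃ Bt : EuclideanSpace ℝ (Fin 3) → EuclideanSpace ℝ (Fin 3),
        LocallyIntegrable Bt volume ∧ eBMOSeminormVec Bt ≤ K' ∧
        ∀ (φ : EuclideanSpace ℝ (Fin 3) → ℝ) (e : EuclideanSpace ℝ (Fin 3)),
          ContDiff ℝ 1 φ → HasCompactSupport φ →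
            ∫ x, φ x * ⟪v t x, e⟫ = ∫ x, ⟪cross (Bt x) (gradient φ x), e⟫) →
      ∀ t < 0, HasNoSwirl (v t))
    {T : ℝ} {u : ℝ → EuclideanSpace ℝ (Fin 3) → EuclideanSpace ℝ (Fin 3)}
    {p : ℝ → EuclideanSpace ℝ (Fin 3) → ℝ} (hT : 0 < T)
    (h : IsClassicalNSSolutionOn (Ioo 0 T) 1 0 u p)
    (hbdd : ∀ T' < T, ∃ M : ℝ, ∀ t ∈ Ioo 0 T', ∀ x, ‖u t x‖ ≤ M)
    (haxi : ∀ t ∈ Ioo 0 T, IsAxisymmetric (u t))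
    (hΓ : ∃ C₁ : ℝ, ∀ t ∈ Ioo 0 T, ∀ x, |swirl (u t) x| ≤ C₁)
    (hB : ∃ (B : ℝ → EuclideanSpace ℝ (Fin 3) → EuclideanSpace ℝ (Fin 3)) (K : ℝ≥0),
      HasBMOStreamFunctionOn (Ioo 0 T) u B K) :
    ∃ M : ℝ, ∀ t ∈ Ioo 0 T, ∀ x, ‖u t x‖ ≤ M := by
  obtain ⟨C₁, hC₁⟩ := hΓ
  obtain ⟨Bs, Kb, hBs⟩ := hB
  by_contra hunb
  -- a bound on `(0, 3T/4) × ℝ³`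
  obtain ⟨Bbar, hBbar⟩ := hbdd (3 * T / 4) (by linarith)
  -- the near-maxima, rotated onto the meridian half-plane
  have hsel := fun n : ℕ => exists_near_max hbdd hunb (((n : ℝ) + 3) * (1 + 1 / T) + |Bbar|)
  choose tn htn xn' hR' hmax' using hsel
  have hmer := fun n : ℕ => exists_meridian_point_norm_eq (haxi _ (htn n)) (xn' n)
  choose xn hx1 hx0 _hx2 hnorm using hmer
  have hR : ∀ n : ℕ, ((n : ℝ) + 3) * (1 + 1 / T) + |Bbar| < ‖u (tn n) (xn n)‖ := fun n => by
    rw [hnorm]; exact hR' n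
  have hmax : ∀ n, ∀ s ∈ Ioc 0 (tn n), ∀ y, ‖u s y‖ ≤ 2 * ‖u (tn n) (xn n)‖ := fun n => by
    rw [hnorm]; exact hmax' n
  have hcyl : ∀ n, cylRadius (xn n) = xn n 0 := fun n =>
    cylRadius_eq_apply_zero (hx1 n) (by rw [hx0]; exact cylRadius_nonneg _)
  set M : ℕ → ℝ := fun n => ‖u (tn n) (xn n)‖ with hMdef
  have hRpos : ∀ n : ℕ, (3 : ℝ) ≤ ((n : ℝ) + 3) * (1 + 1 / T) := fun n => by
    have h1 : (1 : ℝ) ≤ 1 + 1 / T := by simp [hT.le]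
    nlinarith [n.cast_nonneg (α := ℝ)]
  have hM1 : ∀ n : ℕ, ((n : ℝ) + 3) * (1 + 1 / T) ≤ M n := fun n => by
    have := hR n; linarith [abs_nonneg Bbar]
  have hMone : ∀ n, 1 ≤ M n := fun n => by linarith [hRpos n, hM1 n]
  have hMpos : ∀ n, 0 < M n := fun n => by linarith [hMone n]
  have htn34 : ∀ n, 3 * T / 4 ≤ tn n := fun n => by
    by_contra hlt
    push Not at hlt
    have h1 : M n ≤ Bbar := hBbar (tn n) ⟨(htn n).1, hlt⟩ (xn n)
    have h2 : |Bbar| < M n := by have := hR n; linarith [hRpos n]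
    linarith [le_abs_self Bbar]
  -- `t_n M_n² ≥ (n + 3)(3/4)`
  have hAle : ∀ n : ℕ, ((n : ℝ) + 3) * (3 / 4) ≤ tn n * M n ^ 2 := fun n => by
    have h1 : ((n : ℝ) + 3) * (1 + 1 / T) * 1 ≤ M n * M n :=
      mul_le_mul (hM1 n) (hMone n) zero_le_one (hMpos n).le
    have h2 : T * (1 + 1 / T) = T + 1 := by field_simp
    have h3 : 3 * T / 4 * (((n : ℝ) + 3) * (1 + 1 / T)) ≤ tn n * M n ^ 2 := by
      rw [sq]
      exact mul_le_mul (htn34 n) (by simpa using h1) (by nlinarith [hRpos n]) (htn n).1.le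
    have h4 : 3 * T / 4 * (((n : ℝ) + 3) * (1 + 1 / T)) = ((n : ℝ) + 3) * (3 / 4) * (T + 1) := by
      rw [← h2]; ring
    nlinarith [n.cast_nonneg (α := ℝ)]
  have hA2 : ∀ n, 2 ≤ tn n * M n ^ 2 := fun n => by nlinarith [hAle n, n.cast_nonneg (α := ℝ)]
  have hAtop : Tendsto (fun n => tn n * M n ^ 2) atTop atTop := by
    refine tendsto_atTop_mono hAle ?_
    exact (tendsto_natCast_atTop_atTop.atTop_add tendsto_const_nhds).atTop_mul_const (by norm_num)
  -- the dichotomy on `r_n M_n`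
  by_cases hcase : ∃ D : ℝ, ∃ᶠ n in atTop, M n * xn n 0 ≤ D
  · -- Case 1: `r_n M_n` bounded along a subsequence
    obtain ⟨D, hD⟩ := hcase
    obtain ⟨ρ, hρ, hρD⟩ := extraction_of_frequently_atTop hD
    exact case1_falseU h haxi hC₁ hBs hstep (tn := tn ∘ ρ) (xn := xn ∘ ρ) (fun n => htn (ρ n))
      (fun n => hMpos (ρ n)) (fun n => hmax (ρ n)) (fun n => hA2 (ρ n))
      (hAtop.comp hρ.tendsto_atTop) (D := D) fun n => by
        show cylRadius (xn (ρ n)) * M (ρ n) ≤ D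
        rw [hcyl, mul_comm]; exact hρD n
  · -- Case 2: `r_n M_n → ∞`
    simp only [not_exists, not_frequently, not_le] at hcase
    have hRt : Tendsto (fun n => M n * xn n 0) atTop atTop :=
      tendsto_atTop.2 fun D => (hcase D).mono fun n hn => hn.le
    exact case2_false h haxi hC₁ hBs htn hx1 hMpos hmax hA2 hAtop hRt

/-- **Lei–Zhang 2011, Theorem 1.4 (classical frame, datum form), conditional on the swirl
step.** As `LeiZhang2011_regularity_classical_of_swirlStep`, for a classical solution on the
half-open slab `[0, T) × ℝ³` bounded on every closed sub-slab `[0, T'] × ℝ³`, `T' < T`, with the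
bound on `Γ = r v^θ` assumed **at the initial time only** ("Note condition `|r v^θ(x, 0)| < C`
is only on the initial value", Remark 1.5): the maximum principle for the swirl
(`abs_swirl_le_of_classical`, "`r v^θ` … satisfies the maximum principle", p. 4) propagates it
to `(0, T)`. [cite: LeiZhang2011, Thm. 1.4, Rem. 1.5 and proof §4 (arXiv pp. 4, 12–13)] -/
theorem LeiZhang2011_regularity_classical_datum_of_swirlStepU
    (hstep : ∀ (v : ℝ → EuclideanSpace ℝ (Fin 3) → EuclideanSpace ℝ (Fin 3)) (C : ℝ)
      (K' : ℝ≥0),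
      IsBoundedWeakNSSolutionOn (Iio 0) isOpen_Iio 1 v → Continuous (uncurry v) →
      (∀ t < 0, IsAxisymmetric (v t)) → (∀ t < 0, ∀ x, |swirl (v t) x| ≤ C) →
      (∀ t < 0, ∃ Bt : EuclideanSpace ℝ (Fin 3) → EuclideanSpace ℝ (Fin 3),
        LocallyIntegrable Bt volume ∧ eBMOSeminormVec Bt ≤ K' ∧
        ∀ (φ : EuclideanSpace ℝ (Fin 3) → ℝ) (e : EuclideanSpace ℝ (Fin 3)),
          ContDiff ℝ 1 φ → HasCompactSupport φ →
            ∫ x, φ x * ⟪v t x, e⟫ = ∫ x, ⟪cross (Bt x) (gradient φ x), e⟫) →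
      ∀ t < 0, HasNoSwirl (v t))
    {T : ℝ} {u : ℝ → EuclideanSpace ℝ (Fin 3) → EuclideanSpace ℝ (Fin 3)}
    {p : ℝ → EuclideanSpace ℝ (Fin 3) → ℝ} (hT : 0 < T)
    (h : IsClassicalNSSolutionOn (Ico 0 T) 1 0 u p)
    (hbdd : ∀ T' < T, ∃ M : ℝ, ∀ t ∈ Icc 0 T', ∀ x, ‖u t x‖ ≤ M)
    (haxi : ∀ t ∈ Ico 0 T, IsAxisymmetric (u t))
    (hΓ₀ : ∃ C : ℝ, ∀ x, |swirl (u 0) x| ≤ C)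
    (hB : ∃ (B : ℝ → EuclideanSpace ℝ (Fin 3) → EuclideanSpace ℝ (Fin 3)) (K : ℝ≥0),
      HasBMOStreamFunctionOn (Ioo 0 T) u B K) :
    ∃ M : ℝ, ∀ t ∈ Ioo 0 T, ∀ x, ‖u t x‖ ≤ M := by
  obtain ⟨C, hC⟩ := hΓ₀
  -- the maximum principle for the swirl on every closed sub-slab `[0, T']`
  have hΓ : ∀ t ∈ Ioo 0 T, ∀ x, |swirl (u t) x| ≤ C := by
    intro t ht x
    obtain ⟨T', htT', hT'T⟩ := exists_between ht.2
    have hT' : 0 < T' := ht.1.trans htT'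
    obtain ⟨V, hV⟩ := hbdd T' hT'T
    have hcl : IsClassicalNSSolutionOn (Icc 0 T') 1 0 u p :=
      h.mono (Icc_subset_Ico_right hT'T) (uniqueDiffOn_Icc hT')
    exact abs_swirl_le_of_classical one_pos hT' hcl (fun s hs => haxi s ⟨hs.1, hs.2.trans_lt hT'T⟩)
      hV hC t ⟨ht.1.le, htT'.le⟩ x
  exact LeiZhang2011_regularity_classical_of_swirlStepU hstep hT
    (h.mono Ioo_subset_Ico_self (uniqueDiffOn_Ioo 0 T))
    (fun T' hT' => (hbdd T' hT').imp fun M hM t ht x => hM t ⟨ht.1.le, ht.2.le⟩ x)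
    (fun t ht => haxi t ⟨ht.1.le, ht.2⟩) ⟨C, hΓ⟩ hB

/-- **Lei–Zhang 2011, Theorem 1.4 (classical frame, continuation form), conditional on the swirl
step: no first blow-up time.** A classical solution of Navier–Stokes (`ν = 1`) on `[0, T) × ℝ³`
which is Leray–Hopf from `u 0`, bounded on every `[0, T'] × ℝ³`, `T' < T`, axisymmetric, with
`|r v^θ(·, 0)| ≤ C` and a stream function in `L^∞((0, T); BMO)`, extends as a classical solution
past `T` — provided the swirl step holds. (`LeiZhang2011_regularity_classical_datum_of_swirlStep`
bounds `u` on `(0, T) × ℝ³`; the proved continuation principle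
`hasSmoothExtensionPast_of_bounded_holds` — Robinson–Rodrigo–Sadowski 2016, Thm. 8.17 — continues
the bounded Leray–Hopf solution; this is the form "`t = 0` is a blow up time of `v` … This
contradiction proves that singularity can not occur" of the printed proof, p. 12.) [cite: LeiZhang2011, Thm. 1.4 and proof §4 (arXiv pp. 4, 12–13)] -/
theorem LeiZhang2011_hasSmoothExtensionPast_of_swirlStepU
    (hstep : ∀ (v : ℝ → EuclideanSpace ℝ (Fin 3) → EuclideanSpace ℝ (Fin 3)) (C : ℝ)
      (K' : ℝ≥0),
      IsBoundedWeakNSSolutionOn (Iio 0) isOpen_Iio 1 v → Continuous (uncurry v) →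
      (∀ t < 0, IsAxisymmetric (v t)) → (∀ t < 0, ∀ x, |swirl (v t) x| ≤ C) →
      (∀ t < 0, ∃ Bt : EuclideanSpace ℝ (Fin 3) → EuclideanSpace ℝ (Fin 3),
        LocallyIntegrable Bt volume ∧ eBMOSeminormVec Bt ≤ K' ∧
        ∀ (φ : EuclideanSpace ℝ (Fin 3) → ℝ) (e : EuclideanSpace ℝ (Fin 3)),
          ContDiff ℝ 1 φ → HasCompactSupport φ →
            ∫ x, φ x * ⟪v t x, e⟫ = ∫ x, ⟪cross (Bt x) (gradient φ x), e⟫) →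
      ∀ t < 0, HasNoSwirl (v t))
    {T : ℝ} {u : ℝ → EuclideanSpace ℝ (Fin 3) → EuclideanSpace ℝ (Fin 3)}
    {p : ℝ → EuclideanSpace ℝ (Fin 3) → ℝ} (hT : 0 < T)
    (h : IsClassicalNSSolutionOn (Ico 0 T) 1 0 u p) (hLH : IsLerayHopfOn T 1 0 (u 0) u)
    (hbdd : ∀ T' < T, ∃ M : ℝ, ∀ t ∈ Icc 0 T', ∀ x, ‖u t x‖ ≤ M)
    (haxi : ∀ t ∈ Ico 0 T, IsAxisymmetric (u t))
    (hΓ₀ : ∃ C : ℝ, ∀ x, |swirl (u 0) x| ≤ C)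
    (hB : ∃ (B : ℝ → EuclideanSpace ℝ (Fin 3) → EuclideanSpace ℝ (Fin 3)) (K : ℝ≥0),
      HasBMOStreamFunctionOn (Ioo 0 T) u B K) :
    HasSmoothExtensionPast 1 0 u T :=
  hasSmoothExtensionPast_of_bounded_holds one_pos hT h hLH (exists_bound_Ico_of_Ioo hT hbdd
    (LeiZhang2011_regularity_classical_datum_of_swirlStepU hstep hT h hbdd haxi hΓ₀ hB))


end Classical

/-! ## The Leray–Hopf frame -/

section LerayHopf

/-! ### The bound near the right end of an interval of regularity -/

/-- **The blow-up criterion on an interval of regularity.** Let `u` be Leray–Hopf on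
`ℝ³ × [0, T)` (`ν = 1`) with axisymmetric slices, `|Γ| ≤ C₁` a.e. on every slice of `(0, T)`
and a stream function with `BMO` slices on `(0, T)`, and assume the swirl step. If `u` is
`H¹`-regular on `(α, β)`, `0 ≤ α < β ≤ T`, then `u` is essentially bounded on
`(β − δ, β) × ℝ³` for some `δ > 0`: from a good time `s ∈ (α, β)` the solution is classical on
`(s, β)` (`exists_classical_Ioo_of_isH1RegularOn`), bounded on the compact sub-slabs
(`exists_ae_bound_Icc_of_isH1RegularOn`), axisymmetric with `|Γ| ≤ C₁` and the same stream
functions (transport to the continuous representative), so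
`LeiZhang2011_regularity_classical_of_swirlStep` (applied from `s' = (s + β)/2`) bounds it up
to `β`. [cite: LeiZhang2011, Thm. 1.4, proof §4 (arXiv p. 12)] -/
theorem ae_bound_near_of_isH1RegularOn_of_swirlStepU
    (hstep : ∀ (v : ℝ → EuclideanSpace ℝ (Fin 3) → EuclideanSpace ℝ (Fin 3)) (C : ℝ)
      (K' : ℝ≥0),
      IsBoundedWeakNSSolutionOn (Iio 0) isOpen_Iio 1 v → Continuous (uncurry v) →
      (∀ t < 0, IsAxisymmetric (v t)) → (∀ t < 0, ∀ x, |swirl (v t) x| ≤ C) →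
      (∀ t < 0, ∃ Bt : EuclideanSpace ℝ (Fin 3) → EuclideanSpace ℝ (Fin 3),
        LocallyIntegrable Bt volume ∧ eBMOSeminormVec Bt ≤ K' ∧
        ∀ (φ : EuclideanSpace ℝ (Fin 3) → ℝ) (e : EuclideanSpace ℝ (Fin 3)),
          ContDiff ℝ 1 φ → HasCompactSupport φ →
            ∫ x, φ x * ⟪v t x, e⟫ = ∫ x, ⟪cross (Bt x) (gradient φ x), e⟫) →
      ∀ t < 0, HasNoSwirl (v t))
    {T : ℝ} {u₀ : EuclideanSpace ℝ (Fin 3) → EuclideanSpace ℝ (Fin 3)}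
    {u : ℝ → EuclideanSpace ℝ (Fin 3) → EuclideanSpace ℝ (Fin 3)}
    (hLH : IsLerayHopfOn T 1 0 u₀ u) (haxi : ∀ t ∈ Ioo 0 T, IsAxisymmetric (u t))
    {C₁ : ℝ} (hΓ : ∀ t ∈ Ioo 0 T, ∀ᵐ x ∂volume, |swirl (u t) x| ≤ C₁)
    {Bs : ℝ → EuclideanSpace ℝ (Fin 3) → EuclideanSpace ℝ (Fin 3)} {Kb : ℝ≥0}
    (hBs : HasBMOStreamFunctionOn (Ioo 0 T) u Bs Kb)
    {α β : ℝ} (hα : 0 ≤ α) (hαβ : α < β) (hβ : β ≤ T) (hreg : IsH1RegularOn (Ioo α β) u) :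
    ∃ δ M : ℝ, 0 < δ ∧ ∀ t ∈ Ioo (β - δ) β, ∀ᵐ x ∂volume, ‖u t x‖ ≤ M := by
  -- a good time and the classical representative on `(s, β)`
  obtain ⟨s, hs, hLHs⟩ := hLH.exists_isLerayHopfOn_restart_Ioo zero_le_one hα hαβ hβ
  obtain ⟨V, P, hV, hrep⟩ := exists_classical_Ioo_of_isH1RegularOn one_pos hβ hreg hs hLHs
  have h0s : 0 < s := hα.trans_lt hs.1
  have hmemT : ∀ t ∈ Ioo s β, t ∈ Ioo 0 T := fun t ht => ⟨h0s.trans ht.1, ht.2.trans_le hβ⟩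
  have hVc : ∀ t ∈ Ioo s β, Continuous (V t) := fun t ht => (hV.contDiff_velocity ht).continuous
  -- transport of the hypotheses to `V`
  have hVaxi : ∀ t ∈ Ioo s β, IsAxisymmetric (V t) := fun t ht =>
    (haxi t (hmemT t ht)).of_ae_eq (hrep t ht) (hVc t ht)
  have hVΓ : ∀ t ∈ Ioo s β, ∀ x, |swirl (V t) x| ≤ C₁ := fun t ht =>
    forall_abs_swirl_le_of_ae (hΓ t (hmemT t ht)) (hrep t ht) (hVc t ht)
  have hVB : HasBMOStreamFunctionOn (Ioo s β) V Bs Kb :=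
    (hBs.mono fun t ht => hmemT t ht).congr_ae hrep
  have hVnorm : ∀ t ∈ Ioo s β, ∀ M : ℝ, (∀ᵐ x ∂volume, ‖u t x‖ ≤ M) → ∀ x, ‖V t x‖ ≤ M := by
    intro t ht M hM
    refine forall_norm_le_of_ae_bound (hVc t ht) ?_
    filter_upwards [hM, hrep t ht] with x hx hx'
    rwa [hx'] at hx
  -- the starting time `s' = (s + β)/2` and the bounds on the earlier slabs
  set s' : ℝ := (s + β) / 2 with hs'
  have hss' : s < s' := by rw [hs']; linarith [hs.2]
  have hs'β : s' < β := by rw [hs']; linarith [hs.2]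
  have hVbd : ∀ T' < β - s', ∃ M : ℝ, ∀ t ∈ Ioo 0 T', ∀ x, ‖V (t + s') x‖ ≤ M := by
    intro T' hT'
    rcases le_or_gt T' 0 with hle | hpos
    · exact ⟨0, fun t ht x => absurd (ht.1.trans ht.2) (not_lt.2 hle)⟩
    obtain ⟨M, hM⟩ := exists_ae_bound_Icc_of_isH1RegularOn one_pos hLH hα hβ hreg
      (a := s') (b := s' + T') (hs.1.trans hss') (by linarith)
    refine ⟨M, fun t ht x => ?_⟩
    have hts : t + s' ∈ Ioo s β := ⟨by linarith [ht.1], by linarith [ht.2]⟩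
    exact hVnorm _ hts M (hM (t + s') ⟨by linarith [ht.1], by linarith [ht.2]⟩) x
  -- the shifted classical solution on `(0, β - s')`
  have hVs : IsClassicalNSSolutionOn (Ioo 0 (β - s')) 1 0 (fun t => V (t + s'))
      (fun t => P (t + s')) := by
    have h := hV.comp_add_right s'
    have h0 : (fun t => (0 : ℝ → EuclideanSpace ℝ (Fin 3) → EuclideanSpace ℝ (Fin 3)) (t + s')) =
        0 := rfl
    rw [h0] at h
    exact h.mono (fun t ht => ⟨by simp only; linarith [ht.1], by simp only; linarith [ht.2]⟩)
      (uniqueDiffOn_Ioo _ _)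
  have hmem' : ∀ t ∈ Ioo 0 (β - s'), t + s' ∈ Ioo s β := fun t ht =>
    ⟨by linarith [ht.1], by linarith [ht.2]⟩
  obtain ⟨M, hM⟩ := LeiZhang2011_regularity_classical_of_swirlStepU hstep (sub_pos.2 hs'β) hVs
    hVbd (fun t ht => hVaxi (t + s') (hmem' t ht)) ⟨C₁, fun t ht x => hVΓ (t + s') (hmem' t ht) x⟩
    ⟨fun t => Bs (t + s'), Kb, fun t ht => hVB (t + s') (hmem' t ht)⟩
  -- back to `u` on `(s', β)`
  refine ⟨β - s', M, sub_pos.2 hs'β, fun t ht => ?_⟩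
  have ht' : t ∈ Ioo s β := ⟨by linarith [ht.1], ht.2⟩
  have h1 := hM (t - s') ⟨by linarith [ht.1], by linarith [ht.2]⟩
  simp only [sub_add_cancel] at h1
  filter_upwards [hrep t ht'] with x hx
  rw [hx]
  exact h1 x

/-! ### Theorem 1.4 for Leray–Hopf solutions, conditional on the swirl step -/

/-- **Lei–Zhang 2011, Theorem 1.4 for Leray–Hopf weak solutions (conditional on the swirl step;
`Γ` bounded on the slab).** Let `u` be a Leray–Hopf weak solution of the unforced
Navier–Stokes system (`ν = 1`) on `ℝ³ × [0, T)` with axisymmetric slices, `|r u^θ| ≤ C₁` a.e.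
on every slice of `(0, T)`, and a stream function with `BMO` slices on `(0, T)`
(`HasBMOStreamFunctionOn`). Assume the swirl step (Theorem 1.1 of the paper for the blow-up
limit class). Then `u` has a classical representative on `(0, T]`: a classical solution
`(V, P)` on the time set `(0, T]` with `u(t) = V(t)` a.e. for every `t ∈ (0, T]` ("`v` is
smooth in `ℝ³ × (0, T]`"). Proof: Leray's continuation theorem `leray_continuation_H1_holds`
with the hypothesis supplied by `ae_bound_near_of_isH1RegularOn_of_swirlStep` and
`limsup_eH1NormSq_lt_top_of_ae_bound_near`, then `classical_of_isH1RegularOn`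
(`ladyzhenskaya_prodi_serrin_holds`). [cite: LeiZhang2011, Thm. 1.4 and proof §4 (arXiv pp. 4, 12–13)] -/
theorem LeiZhang2011_regularity_lerayHopf_of_swirlStepU
    (hstep : ∀ (v : ℝ → EuclideanSpace ℝ (Fin 3) → EuclideanSpace ℝ (Fin 3)) (C : ℝ)
      (K' : ℝ≥0),
      IsBoundedWeakNSSolutionOn (Iio 0) isOpen_Iio 1 v → Continuous (uncurry v) →
      (∀ t < 0, IsAxisymmetric (v t)) → (∀ t < 0, ∀ x, |swirl (v t) x| ≤ C) →
      (∀ t < 0, ∃ Bt : EuclideanSpace ℝ (Fin 3) → EuclideanSpace ℝ (Fin 3),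
        LocallyIntegrable Bt volume ∧ eBMOSeminormVec Bt ≤ K' ∧
        ∀ (φ : EuclideanSpace ℝ (Fin 3) → ℝ) (e : EuclideanSpace ℝ (Fin 3)),
          ContDiff ℝ 1 φ → HasCompactSupport φ →
            ∫ x, φ x * ⟪v t x, e⟫ = ∫ x, ⟪cross (Bt x) (gradient φ x), e⟫) →
      ∀ t < 0, HasNoSwirl (v t))
    {T : ℝ} {u₀ : EuclideanSpace ℝ (Fin 3) → EuclideanSpace ℝ (Fin 3)}
    {u : ℝ → EuclideanSpace ℝ (Fin 3) → EuclideanSpace ℝ (Fin 3)} (hT : 0 < T)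
    (hLH : IsLerayHopfOn T 1 0 u₀ u) (haxi : ∀ t ∈ Ioo 0 T, IsAxisymmetric (u t))
    (hΓ : ∃ C₁ : ℝ, ∀ t ∈ Ioo 0 T, ∀ᵐ x ∂volume, |swirl (u t) x| ≤ C₁)
    (hB : ∃ (B : ℝ → EuclideanSpace ℝ (Fin 3) → EuclideanSpace ℝ (Fin 3)) (K : ℝ≥0),
      HasBMOStreamFunctionOn (Ioo 0 T) u B K) :
    ∃ (V : ℝ → EuclideanSpace ℝ (Fin 3) → EuclideanSpace ℝ (Fin 3))
      (P : ℝ → EuclideanSpace ℝ (Fin 3) → ℝ),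
      IsClassicalNSSolutionOn (Ioc 0 T) 1 0 V P ∧ ∀ t ∈ Ioc 0 T, u t =ᵐ[volume] V t := by
  obtain ⟨C₁, hC₁⟩ := hΓ
  obtain ⟨Bs, Kb, hBs⟩ := hB
  have hhyp : ∀ α β : ℝ, 0 ≤ α → α < β → β ≤ T → IsH1RegularOn (Ioo α β) u →
      limsup (fun t => eH1NormSq (u t)) (𝓝[<] β) < ⊤ := by
    intro α β hα hαβ hβ hreg
    obtain ⟨δ, M, hδ, hbd⟩ :=
      ae_bound_near_of_isH1RegularOn_of_swirlStepU hstep hLH haxi hC₁ hBs hα hαβ hβ hreg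
    exact limsup_eH1NormSq_lt_top_of_ae_bound_near one_pos hLH hα hαβ hβ hreg hδ hbd
  have hreg : IsH1RegularOn (Ioc 0 T) u := leray_continuation_H1_holds 1 T one_pos hT u₀ u hLH hhyp
  exact classical_of_isH1RegularOn ladyzhenskaya_prodi_serrin_holds one_pos hT hLH hreg

/-- **Lei–Zhang 2011, Theorem 1.4 in the shape of the named fact
`LeiZhang2011_regularity_bmoStream`, conditional on the swirl step and with the bound on
`Γ = r v^θ` assumed on the slab `(0, T)` (a.e. on each slice) instead of at the initial time.**
For a Leray–Hopf weak solution `v` on `ℝ³ × [0, T)` from `v 0` with axisymmetric slices, such a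
bound, and a stream function with `BMO` slices: there is `w`, smooth on `(0, T] × ℝ³`, with
`v = w` a.e. on `(0, T) × ℝ³` (the classical representative of
`LeiZhang2011_regularity_lerayHopf_of_swirlStep`; slice-wise a.e. equality is upgraded to the
slab by `uncurry_ae_eq_restrict_prod_of_forall_slice_ae_eq`). The hypothesis that `(v, p)` is a
*suitable* weak solution is not needed for this implication. What separates this theorem from
the named fact: (i) the swirl step `hstep` = Theorem 1.1 of the paper (Hölder continuity of `Γ`
at the axis, §§2–3), (ii) the passage from `|Γ(·, 0)| ≤ C` to `|Γ| ≤ C` on the slab ("by the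
assumption on initial value and the maximum principle", p. 12), proved in the tree for classical
solutions (`abs_swirl_le_of_classical`) but not along a general Leray–Hopf solution. [cite: LeiZhang2011, Thm. 1.4 (arXiv p. 4) and proof §4 (pp. 12–13)] -/
theorem LeiZhang2011_regularity_bmoStream_of_swirlStepU_of_swirlBound
    (hstep : ∀ (v : ℝ → EuclideanSpace ℝ (Fin 3) → EuclideanSpace ℝ (Fin 3)) (C : ℝ)
      (K' : ℝ≥0),
      IsBoundedWeakNSSolutionOn (Iio 0) isOpen_Iio 1 v → Continuous (uncurry v) →
      (∀ t < 0, IsAxisymmetric (v t)) → (∀ t < 0, ∀ x, |swirl (v t) x| ≤ C) →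
      (∀ t < 0, ∃ Bt : EuclideanSpace ℝ (Fin 3) → EuclideanSpace ℝ (Fin 3),
        LocallyIntegrable Bt volume ∧ eBMOSeminormVec Bt ≤ K' ∧
        ∀ (φ : EuclideanSpace ℝ (Fin 3) → ℝ) (e : EuclideanSpace ℝ (Fin 3)),
          ContDiff ℝ 1 φ → HasCompactSupport φ →
            ∫ x, φ x * ⟪v t x, e⟫ = ∫ x, ⟪cross (Bt x) (gradient φ x), e⟫) →
      ∀ t < 0, HasNoSwirl (v t))
    {T : ℝ} (hT : 0 < T) {v : ℝ → EuclideanSpace ℝ (Fin 3) → EuclideanSpace ℝ (Fin 3)}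
    (hLH : IsLerayHopfOn T 1 0 (v 0) v) (haxi : ∀ t ∈ Ioo 0 T, IsAxisymmetric (v t))
    (hΓ : ∃ C : ℝ, ∀ t ∈ Ioo 0 T, ∀ᵐ x ∂volume, |swirl (v t) x| ≤ C)
    (hB : ∃ (B : ℝ → EuclideanSpace ℝ (Fin 3) → EuclideanSpace ℝ (Fin 3)) (C : ℝ≥0),
      HasBMOStreamFunctionOn (Ioo 0 T) v B C) :
    ∃ w : ℝ → EuclideanSpace ℝ (Fin 3) → EuclideanSpace ℝ (Fin 3),
      IsSmoothSpaceTimeOn (Ioc 0 T) w ∧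
        uncurry v =ᵐ[volume.restrict (Ioo 0 T ×ˢ univ)] uncurry w := by
  obtain ⟨V, P, hV, hrep⟩ := LeiZhang2011_regularity_lerayHopf_of_swirlStepU hstep hT hLH haxi hΓ hB
  refine ⟨V, hV.smooth_velocity, ?_⟩
  refine uncurry_ae_eq_restrict_prod_of_forall_slice_ae_eq measurableSet_Ioo
    (fun t ht => hrep t ⟨ht.1, ht.2.le⟩) hLH.weak.1 ?_
  exact (hV.smooth_velocity.continuousOn.mono (prod_mono Ioo_subset_Ioc_self Subset.rfl)
    ).aestronglyMeasurable (measurableSet_Ioo.prod MeasurableSet.univ)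


end LerayHopf

/-! ## Smooth data -/

section Smooth

variable {T : ℝ} {v : ℝ → EuclideanSpace ℝ (Fin 3) → EuclideanSpace ℝ (Fin 3)}

/-! ### Theorem 1.4 for smooth data -/

/-- **Lei–Zhang 2011, Theorem 1.4 for Leray–Hopf solutions from smooth data, conditional on the
swirl step.** Let `v` be a Leray–Hopf weak solution of the unforced Navier–Stokes system
(`ν = 1`) on `ℝ³ × [0, T)` from a smooth divergence-free datum `v 0` with all derivatives in `L²`,
with axisymmetric slices on `(0, T)`, `|r v^θ(·, 0)| ≤ C`, and a stream function with `BMO`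
slices on `(0, T)`; assume the swirl step (Theorem 1.1 of the paper for the blow-up limit class).
Then `v` has a classical representative `(V, P)` on the closed slab `[0, T] × ℝ³`, `V 0 = v 0`,
`v(t) = V(t)` a.e. for every `t ∈ [0, T)`. Proof: the supremum `β*` of
`S = {β ≤ T : [0, β) carries a bounded classical representative from v 0}` (nonempty by
`exists_classical_Ico_rep_of_smooth_datum`) carries one (glue); it is axisymmetric down to
`t = 0`, with `|Γ(·, 0)| ≤ C` and the transferred stream functions, so
`LeiZhang2011_regularity_classical_datum_of_swirlStep` bounds it on `[0, β*)`, and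
`exists_classical_extension_of_bounded_rep` continues it past `β*` with bounds — beyond `T`,
since otherwise `S` would contain a larger element. [cite: LeiZhang2011, Thm. 1.4, Rem. 1.5 and proof §4 (arXiv pp. 4, 12–13)] -/
theorem LeiZhang2011_regularity_smoothDatum_of_swirlStepU
    (hstep : ∀ (w : ℝ → EuclideanSpace ℝ (Fin 3) → EuclideanSpace ℝ (Fin 3)) (C : ℝ)
      (K' : ℝ≥0),
      IsBoundedWeakNSSolutionOn (Iio 0) isOpen_Iio 1 w → Continuous (uncurry w) →
      (∀ t < 0, IsAxisymmetric (w t)) → (∀ t < 0, ∀ x, |swirl (w t) x| ≤ C) →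
      (∀ t < 0, ∃ Bt : EuclideanSpace ℝ (Fin 3) → EuclideanSpace ℝ (Fin 3),
        LocallyIntegrable Bt volume ∧ eBMOSeminormVec Bt ≤ K' ∧
        ∀ (φ : EuclideanSpace ℝ (Fin 3) → ℝ) (e : EuclideanSpace ℝ (Fin 3)),
          ContDiff ℝ 1 φ → HasCompactSupport φ →
            ∫ x, φ x * ⟪w t x, e⟫ = ∫ x, ⟪cross (Bt x) (gradient φ x), e⟫) →
      ∀ t < 0, HasNoSwirl (w t))
    (hT : 0 < T) (hLH : IsLerayHopfOn T 1 0 (v 0) v)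
    (h0 : ContDiff ℝ (⊤ : ℕ∞) (v 0)) (h0div : VectorCalculus.IsDivFree (v 0))
    (h0sob : ∀ n : ℕ, ∫⁻ x, ‖iteratedFDeriv ℝ n (v 0) x‖ₑ ^ 2 < ⊤)
    (haxi : ∀ t ∈ Ioo 0 T, IsAxisymmetric (v t)) (hΓ₀ : ∃ C : ℝ, ∀ x, |swirl (v 0) x| ≤ C)
    (hB : ∃ (B : ℝ → EuclideanSpace ℝ (Fin 3) → EuclideanSpace ℝ (Fin 3)) (K : ℝ≥0),
      HasBMOStreamFunctionOn (Ioo 0 T) v B K) :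
    ∃ (V : ℝ → EuclideanSpace ℝ (Fin 3) → EuclideanSpace ℝ (Fin 3))
      (P : ℝ → EuclideanSpace ℝ (Fin 3) → ℝ),
      IsClassicalNSSolutionOn (Icc 0 T) 1 0 V P ∧ V 0 = v 0 ∧
        ∀ t ∈ Ico 0 T, v t =ᵐ[volume] V t := by
  obtain ⟨Bs, Kb, hBs⟩ := hB
  -- the admissible ends
  set S : Set ℝ := {β | 0 < β ∧ β ≤ T ∧
    ∃ (V : ℝ → EuclideanSpace ℝ (Fin 3) → EuclideanSpace ℝ (Fin 3))
      (P : ℝ → EuclideanSpace ℝ (Fin 3) → ℝ),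
      IsClassicalNSSolutionOn (Ico 0 β) 1 0 V P ∧ V 0 = v 0 ∧
      (∀ t ∈ Ico 0 β, v t =ᵐ[volume] V t) ∧
      ∀ τ < β, ∃ M : ℝ, ∀ t ∈ Icc 0 τ, ∀ x, ‖V t x‖ ≤ M} with hSdef
  obtain ⟨ε, hε, hεT, V₁, P₁, hV₁, hV₁0, hrep₁, M₁, hM₁⟩ :=
    exists_classical_Ico_rep_of_smooth_datum hT hLH h0 h0div h0sob
  have hεS : ε ∈ S := ⟨hε, hεT, V₁, P₁, hV₁, hV₁0, hrep₁, fun τ hτ =>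
    ⟨M₁, fun t ht x => hM₁ t ⟨ht.1, ht.2.trans_lt hτ⟩ x⟩⟩
  have hSne : S.Nonempty := ⟨ε, hεS⟩
  have hSbdd : BddAbove S := ⟨T, fun β hβ => hβ.2.1⟩
  set βs : ℝ := sSup S with hβsdef
  have hβsT : βs ≤ T := csSup_le hSne fun β hβ => hβ.2.1
  have hεβs : ε ≤ βs := le_csSup hSbdd hεS
  have hβs : 0 < βs := hε.trans_le hεβs
  -- a sequence in `S` increasing to `βs`, and the glued representative on `[0, βs)`
  have hseq : ∀ n : ℕ, ∃ β ∈ S, βs - 1 / ((n : ℝ) + 1) < β := fun n =>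
    exists_lt_of_lt_csSup hSne
      (by rw [hβsdef]; linarith [(by positivity : (0 : ℝ) < 1 / ((n : ℝ) + 1))])
  choose b hbS hblt using hseq
  have hbβ : ∀ n, b n ≤ βs := fun n => le_csSup hSbdd (hbS n)
  have hb : ∀ t, t < βs → ∃ n, t < b n := by
    intro t ht
    obtain ⟨n, hn⟩ := exists_nat_gt (1 / (βs - t))
    refine ⟨n, lt_of_le_of_lt ?_ (hblt n)⟩
    have hpos : 0 < βs - t := sub_pos.2 ht
    have h1 : 1 / ((n : ℝ) + 1) < βs - t := by
      rw [div_lt_iff₀ (by positivity)]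
      rw [div_lt_iff₀ hpos] at hn
      nlinarith
    linarith
  choose Vn Pn hVn hVn0 hrepn hbdn using fun n => (hbS n).2.2
  have hagree : ∀ m n, ∀ t ∈ Ico 0 (min (b m) (b n)), Vn m t = Vn n t := by
    intro m n t ht
    have htm : t ∈ Ico 0 (b m) := ⟨ht.1, ht.2.trans_le (min_le_left _ _)⟩
    have htn : t ∈ Ico 0 (b n) := ⟨ht.1, ht.2.trans_le (min_le_right _ _)⟩
    exact eq_of_ae_eq_of_continuous ((hVn m).contDiff_velocity htm).continuous
      ((hVn n).contDiff_velocity htn).continuous ((hrepn m t htm).symm.trans (hrepn n t htn))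
  obtain ⟨V, P, hV, hVeq⟩ := IsClassicalNSSolutionOn.exists_glue_Ico_right hbβ hb hVn hagree
  have hV0 : V 0 = v 0 := by
    obtain ⟨n, hn⟩ := hb 0 hβs
    rw [hVeq n 0 ⟨le_rfl, hn⟩, hVn0 n]
  have hrep : ∀ t ∈ Ico 0 βs, v t =ᵐ[volume] V t := by
    intro t ht
    obtain ⟨n, hn⟩ := hb t ht.2
    rw [hVeq n t ⟨ht.1, hn⟩]
    exact hrepn n t ⟨ht.1, hn⟩
  have hbdd : ∀ τ < βs, ∃ M : ℝ, ∀ t ∈ Icc 0 τ, ∀ x, ‖V t x‖ ≤ M := by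
    intro τ hτ
    obtain ⟨n, hn⟩ := hb τ hτ
    obtain ⟨M, hM⟩ := hbdn n τ hn
    exact ⟨M, fun t ht x => by rw [hVeq n t ⟨ht.1, ht.2.trans_lt hn⟩]; exact hM t ht x⟩
  -- the hypotheses of the classical-frame theorem for `V` on `[0, βs)`
  have hmemT : ∀ t ∈ Ioo 0 βs, t ∈ Ioo 0 T := fun t ht => ⟨ht.1, ht.2.trans_le hβsT⟩
  have hVaxi' : ∀ t ∈ Ioo 0 βs, IsAxisymmetric (V t) := fun t ht =>
    (haxi t (hmemT t ht)).of_ae_eq (hrep t ⟨ht.1.le, ht.2⟩)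
      (hV.contDiff_velocity ⟨ht.1.le, ht.2⟩).continuous
  have hVaxi : ∀ t ∈ Ico 0 βs, IsAxisymmetric (V t) := by
    intro t ht
    rcases ht.1.eq_or_lt with h | h
    · rw [← h]
      exact isAxisymmetric_zero_of_continuousOn hβs hV.smooth_velocity.continuousOn hVaxi'
    · exact hVaxi' t ⟨h, ht.2⟩
  have hVΓ₀ : ∃ C : ℝ, ∀ x, |swirl (V 0) x| ≤ C := by rw [hV0]; exact hΓ₀
  have hVB : HasBMOStreamFunctionOn (Ioo 0 βs) V Bs Kb :=
    (hBs.mono fun t ht => hmemT t ht).congr_ae fun t ht => hrep t ⟨ht.1.le, ht.2⟩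
  -- the bound up to `βs`
  obtain ⟨M, hM⟩ := LeiZhang2011_regularity_classical_datum_of_swirlStepU hstep hβs hV hbdd hVaxi
    hVΓ₀ ⟨Bs, Kb, hVB⟩
  obtain ⟨M₀, hM₀⟩ := hbdd 0 hβs
  have hMall : ∀ t ∈ Ico 0 βs, ∀ x, ‖V t x‖ ≤ max M M₀ := by
    intro t ht x
    rcases ht.1.eq_or_lt with h | h
    · rw [← h]; exact (hM₀ 0 ⟨le_rfl, le_rfl⟩ x).trans (le_max_right _ _)
    · exact (hM t ⟨h, ht.2⟩ x).trans (le_max_left _ _)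
  -- continuation past `βs`: the new end would lie in `S`, so it exceeds `T`
  obtain ⟨b', hb', V', P', hV', hV'0, hrep', hbdd'⟩ :=
    exists_classical_extension_of_bounded_rep one_pos hLH hβs hβsT hV hrep hMall
  have hTb' : T < b' := by
    by_contra hle
    push Not at hle
    have hmem : b' ∈ S := ⟨hβs.trans hb', hle, V', P', hV', by rw [hV'0, hV0],
      fun t ht => hrep' t ⟨ht.1, lt_min ht.2 (ht.2.trans_le hle)⟩, hbdd'⟩
    exact absurd (le_csSup hSbdd hmem) (not_le.2 hb')
  exact ⟨V', P', hV'.mono (Icc_subset_Ico_right hTb') (uniqueDiffOn_Icc hT), by rw [hV'0, hV0],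
    fun t ht => hrep' t ⟨ht.1, lt_min (ht.2.trans hTb') ht.2⟩⟩

/-- **Lei–Zhang 2011, Theorem 1.4 in the shape of the named fact, for smooth data, conditional
on the swirl step.** For a Leray–Hopf weak solution `v` on `ℝ³ × [0, T)` from a smooth
divergence-free datum `v 0` with all derivatives in `L²`, with axisymmetric slices,
`|r v^θ(·, 0)| ≤ C` and a stream function with `BMO` slices on `(0, T)`: there is `w`, smooth on
`(0, T] × ℝ³` (indeed on `[0, T] × ℝ³`), with `v = w` a.e. on `(0, T) × ℝ³`
(`LeiZhang2011_regularity_smoothDatum_of_swirlStep`; slice-wise a.e. equality upgraded to the slab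
by `uncurry_ae_eq_restrict_prod_of_forall_slice_ae_eq`). [cite: LeiZhang2011, Thm. 1.4 (arXiv p. 4) and proof §4 (pp. 12–13)] -/
theorem LeiZhang2011_regularity_bmoStream_smoothDatum_of_swirlStepU
    (hstep : ∀ (w : ℝ → EuclideanSpace ℝ (Fin 3) → EuclideanSpace ℝ (Fin 3)) (C : ℝ)
      (K' : ℝ≥0),
      IsBoundedWeakNSSolutionOn (Iio 0) isOpen_Iio 1 w → Continuous (uncurry w) →
      (∀ t < 0, IsAxisymmetric (w t)) → (∀ t < 0, ∀ x, |swirl (w t) x| ≤ C) →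
      (∀ t < 0, ∃ Bt : EuclideanSpace ℝ (Fin 3) → EuclideanSpace ℝ (Fin 3),
        LocallyIntegrable Bt volume ∧ eBMOSeminormVec Bt ≤ K' ∧
        ∀ (φ : EuclideanSpace ℝ (Fin 3) → ℝ) (e : EuclideanSpace ℝ (Fin 3)),
          ContDiff ℝ 1 φ → HasCompactSupport φ →
            ∫ x, φ x * ⟪w t x, e⟫ = ∫ x, ⟪cross (Bt x) (gradient φ x), e⟫) →
      ∀ t < 0, HasNoSwirl (w t))
    (hT : 0 < T) (hLH : IsLerayHopfOn T 1 0 (v 0) v)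
    (h0 : ContDiff ℝ (⊤ : ℕ∞) (v 0)) (h0div : VectorCalculus.IsDivFree (v 0))
    (h0sob : ∀ n : ℕ, ∫⁻ x, ‖iteratedFDeriv ℝ n (v 0) x‖ₑ ^ 2 < ⊤)
    (haxi : ∀ t ∈ Ioo 0 T, IsAxisymmetric (v t)) (hΓ₀ : ∃ C : ℝ, ∀ x, |swirl (v 0) x| ≤ C)
    (hB : ∃ (B : ℝ → EuclideanSpace ℝ (Fin 3) → EuclideanSpace ℝ (Fin 3)) (K : ℝ≥0),
      HasBMOStreamFunctionOn (Ioo 0 T) v B K) :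
    ∃ w : ℝ → EuclideanSpace ℝ (Fin 3) → EuclideanSpace ℝ (Fin 3),
      IsSmoothSpaceTimeOn (Ioc 0 T) w ∧
        uncurry v =ᵐ[volume.restrict (Ioo 0 T ×ˢ univ)] uncurry w := by
  obtain ⟨V, P, hV, -, hrep⟩ :=
    LeiZhang2011_regularity_smoothDatum_of_swirlStepU hstep hT hLH h0 h0div h0sob haxi hΓ₀ hB
  refine ⟨V, hV.smooth_velocity.mono Ioc_subset_Icc_self, ?_⟩
  refine uncurry_ae_eq_restrict_prod_of_forall_slice_ae_eq measurableSet_Ioo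
    (fun t ht => hrep t ⟨ht.1.le, ht.2⟩) hLH.weak.1 ?_
  exact (hV.smooth_velocity.continuousOn.mono (prod_mono Ioo_subset_Icc_self Subset.rfl)
    ).aestronglyMeasurable (measurableSet_Ioo.prod MeasurableSet.univ)


end Smooth

/-! ## Theorem 1.1 ⇒ the swirl step; the reductions of the named fact -/

section Reduction

/-! ### Theorem 1.1 ⇒ the swirl step -/

/-- The swirl vanishes at the points of the axis: `Γ(z e₃) = 0`. [folklore] -/
theorem swirl_smul_eZ (u : EuclideanSpace ℝ (Fin 3) → EuclideanSpace ℝ (Fin 3)) (z : ℝ) :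
    swirl u (z • eZ) = 0 := by
  simp [swirl, eZ]

/-- **Theorem 1.1 ⇒ the swirl step** (Lei–Zhang 2011, proof of Thm. 1.2, p. 12, first lines).
Assume Theorem 1.1 in the form: for bounded continuous weak ancient axisymmetric solutions with
`|Γ| ≤ C₁` and stream functions with `sup_t ‖B(t)‖_BMO ≤ K`, `Γ = r v^θ` has a Hölder modulus
at every axis point `(z e₃, t₀)`, `t₀ < 0`, at every scale `L > 0`:
`|Γ(x, t) − Γ(z e₃, t₀)| ≤ C ((‖x − z e₃‖ + √(t₀ − t))/L)^α C₁` for `‖x − z e₃‖ ≤ L/2`,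
`t₀ − (L/2)² ≤ t ≤ t₀`, with `α > 0`, `C` depending only on `(C₁, K)` (hypothesis `hHolder`).
Then every such solution is swirl free: at `t₀ = t`, `z = x₃`, letting `L → ∞` gives
`Γ(x, t) = Γ(x₃ e₃, t) = 0`. [cite: LeiZhang2011, Thm. 1.1 (p. 3) and proof of Thm. 1.2 (p. 12)] -/
theorem swirlStepU_of_holderAtAxis
    (hHolder : ∀ (C₁ : ℝ) (K : ℝ≥0), ∃ α C : ℝ, 0 < α ∧
      ∀ (v : ℝ → EuclideanSpace ℝ (Fin 3) → EuclideanSpace ℝ (Fin 3)),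
        IsBoundedWeakNSSolutionOn (Iio 0) isOpen_Iio 1 v → Continuous (uncurry v) →
        (∀ t < 0, IsAxisymmetric (v t)) → (∀ t < 0, ∀ x, |swirl (v t) x| ≤ C₁) →
        (∀ t < 0, ∃ Bt : EuclideanSpace ℝ (Fin 3) → EuclideanSpace ℝ (Fin 3),
          LocallyIntegrable Bt volume ∧ eBMOSeminormVec Bt ≤ K ∧
          ∀ (φ : EuclideanSpace ℝ (Fin 3) → ℝ) (e : EuclideanSpace ℝ (Fin 3)),
            ContDiff ℝ 1 φ → HasCompactSupport φ →
              ∫ x, φ x * ⟪v t x, e⟫ = ∫ x, ⟪cross (Bt x) (gradient φ x), e⟫) →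
        ∀ (z t₀ : ℝ), t₀ < 0 → ∀ L : ℝ, 0 < L → ∀ (x : EuclideanSpace ℝ (Fin 3)) (t : ℝ),
          ‖x - z • eZ‖ ≤ L / 2 → t₀ - (L / 2) ^ 2 ≤ t → t ≤ t₀ →
            |swirl (v t) x - swirl (v t₀) (z • eZ)| ≤
              C * ((‖x - z • eZ‖ + Real.sqrt (t₀ - t)) / L) ^ α * C₁) :
    ∀ (v : ℝ → EuclideanSpace ℝ (Fin 3) → EuclideanSpace ℝ (Fin 3)) (C₁ : ℝ) (K : ℝ≥0),
      IsBoundedWeakNSSolutionOn (Iio 0) isOpen_Iio 1 v → Continuous (uncurry v) →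
      (∀ t < 0, IsAxisymmetric (v t)) → (∀ t < 0, ∀ x, |swirl (v t) x| ≤ C₁) →
      (∀ t < 0, ∃ Bt : EuclideanSpace ℝ (Fin 3) → EuclideanSpace ℝ (Fin 3),
        LocallyIntegrable Bt volume ∧ eBMOSeminormVec Bt ≤ K ∧
        ∀ (φ : EuclideanSpace ℝ (Fin 3) → ℝ) (e : EuclideanSpace ℝ (Fin 3)),
          ContDiff ℝ 1 φ → HasCompactSupport φ →
            ∫ x, φ x * ⟪v t x, e⟫ = ∫ x, ⟪cross (Bt x) (gradient φ x), e⟫) →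
      ∀ t < 0, HasNoSwirl (v t) := by
  intro v C₁ K hweak hcont haxi hΓ hB t ht x
  obtain ⟨α, C, hα, h⟩ := hHolder C₁ K
  have hmod := h v hweak hcont haxi hΓ hB (x 2) t ht
  set d : ℝ := ‖x - x 2 • eZ‖ with hd
  have hd0 : 0 ≤ d := norm_nonneg _
  -- the bound at scale `L ≥ 2d`, `L > 0`
  have hbound : ∀ L : ℝ, 0 < L → 2 * d ≤ L →
      |swirl (v t) x| ≤ C * ((d / L) ^ α) * C₁ := by
    intro L hL hdL
    have h1 := hmod L hL x t (by rw [← hd]; linarith) (by nlinarith) le_rfl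
    rwa [swirl_smul_eZ, sub_zero, sub_self, Real.sqrt_zero, add_zero] at h1
  -- `(d/L)^α → 0` as `L → ∞`
  have hlim : Tendsto (fun L : ℝ => C * ((d / L) ^ α) * C₁) atTop (𝓝 0) := by
    have h2 : Tendsto (fun L : ℝ => d / L) atTop (𝓝 0) :=
      tendsto_const_nhds.div_atTop tendsto_id
    have h1 : Tendsto (fun L : ℝ => (d / L) ^ α) atTop (𝓝 0) := by
      have h3 := ((Real.continuousAt_rpow_const 0 α (Or.inr hα.le)).tendsto).comp h2
      simpa [Function.comp_def, Real.zero_rpow hα.ne'] using h3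
    simpa using (h1.const_mul C).mul_const C₁
  have hev : ∀ᶠ L in atTop, |swirl (v t) x| ≤ C * ((d / L) ^ α) * C₁ := by
    filter_upwards [eventually_ge_atTop (max (2 * d) 1)] with L hL
    exact hbound L (by linarith [le_max_right (2 * d) 1]) ((le_max_left _ _).trans hL)
  have h0 : |swirl (v t) x| ≤ 0 := le_of_tendsto_of_tendsto tendsto_const_nhds hlim hev
  exact abs_nonpos_iff.1 h0

/-! ### The named fact from Theorem 1.1 and the weak maximum principle -/

/-- **Lei–Zhang 2011, Theorem 1.4 (the named fact `LeiZhang2011_regularity_bmoStream`) from the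
swirl step in its uniform form and the maximum principle for `Γ` along the weak solution.**
The second hypothesis is the sentence "By the assumption on initial value and the maximum
principle" of the printed proof (p. 12) for the solutions of the statement: a suitable Leray–Hopf
solution with axisymmetric slices and `|r v^θ(·, 0)| ≤ C` has `|r v^θ(t, ·)| ≤ C'` a.e. for
`0 < t < T`. Given both, the statement is
`LeiZhang2011_regularity_bmoStream_of_swirlStepU_of_swirlBound`.
[cite: LeiZhang2011, Thm. 1.4 (arXiv p. 4) and proof §4 (pp. 12–13)] -/
theorem LeiZhang2011_regularity_bmoStream_of_swirlStepU_of_weakMaxPrinciple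
    (hstep : ∀ (v : ℝ → EuclideanSpace ℝ (Fin 3) → EuclideanSpace ℝ (Fin 3)) (C : ℝ)
      (K' : ℝ≥0),
      IsBoundedWeakNSSolutionOn (Iio 0) isOpen_Iio 1 v → Continuous (uncurry v) →
      (∀ t < 0, IsAxisymmetric (v t)) → (∀ t < 0, ∀ x, |swirl (v t) x| ≤ C) →
      (∀ t < 0, ∃ Bt : EuclideanSpace ℝ (Fin 3) → EuclideanSpace ℝ (Fin 3),
        LocallyIntegrable Bt volume ∧ eBMOSeminormVec Bt ≤ K' ∧
        ∀ (φ : EuclideanSpace ℝ (Fin 3) → ℝ) (e : EuclideanSpace ℝ (Fin 3)),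
          ContDiff ℝ 1 φ → HasCompactSupport φ →
            ∫ x, φ x * ⟪v t x, e⟫ = ∫ x, ⟪cross (Bt x) (gradient φ x), e⟫) →
      ∀ t < 0, HasNoSwirl (v t))
    (hmax : ∀ (T : ℝ), 0 < T →
      ∀ (v : ℝ → EuclideanSpace ℝ (Fin 3) → EuclideanSpace ℝ (Fin 3))
        (p : ℝ → EuclideanSpace ℝ (Fin 3) → ℝ),
        IsSuitableWeakSolutionOn (slab (EuclideanSpace ℝ (Fin 3)) (Ioo 0 T) isOpen_Ioo) 1 0 v p →
        IsLerayHopfOn T 1 0 (v 0) v → (∀ t ∈ Ioo 0 T, IsAxisymmetric (v t)) →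
        (∃ C : ℝ, ∀ x, |swirl (v 0) x| ≤ C) →
          ∃ C : ℝ, ∀ t ∈ Ioo 0 T, ∀ᵐ x ∂volume, |swirl (v t) x| ≤ C) :
    LeiZhang2011_regularity_bmoStream := by
  intro T hT v p hsuit hLH haxi hΓ₀ hB
  obtain ⟨w, hw, hae⟩ := LeiZhang2011_regularity_bmoStream_of_swirlStepU_of_swirlBound hstep hT hLH
    haxi (hmax T hT v p hsuit hLH haxi hΓ₀) hB
  exact ⟨w, hw, hae⟩

/-- **Lei–Zhang 2011, Theorem 1.4 (the named fact) from Theorem 1.1 and the maximum principle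
for `Γ` along the weak solution** (`swirlStepU_of_holderAtAxis` and
`LeiZhang2011_regularity_bmoStream_of_swirlStepU_of_weakMaxPrinciple`). [cite: LeiZhang2011, Thms. 1.1, 1.4 and §4 (arXiv pp. 3–4, 12–13)] -/
theorem LeiZhang2011_regularity_bmoStream_of_holderAtAxis_of_weakMaxPrinciple
    (hHolder : ∀ (C₁ : ℝ) (K : ℝ≥0), ∃ α C : ℝ, 0 < α ∧
      ∀ (v : ℝ → EuclideanSpace ℝ (Fin 3) → EuclideanSpace ℝ (Fin 3)),
        IsBoundedWeakNSSolutionOn (Iio 0) isOpen_Iio 1 v → Continuous (uncurry v) →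
        (∀ t < 0, IsAxisymmetric (v t)) → (∀ t < 0, ∀ x, |swirl (v t) x| ≤ C₁) →
        (∀ t < 0, ∃ Bt : EuclideanSpace ℝ (Fin 3) → EuclideanSpace ℝ (Fin 3),
          LocallyIntegrable Bt volume ∧ eBMOSeminormVec Bt ≤ K ∧
          ∀ (φ : EuclideanSpace ℝ (Fin 3) → ℝ) (e : EuclideanSpace ℝ (Fin 3)),
            ContDiff ℝ 1 φ → HasCompactSupport φ →
              ∫ x, φ x * ⟪v t x, e⟫ = ∫ x, ⟪cross (Bt x) (gradient φ x), e⟫) →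
        ∀ (z t₀ : ℝ), t₀ < 0 → ∀ L : ℝ, 0 < L → ∀ (x : EuclideanSpace ℝ (Fin 3)) (t : ℝ),
          ‖x - z • eZ‖ ≤ L / 2 → t₀ - (L / 2) ^ 2 ≤ t → t ≤ t₀ →
            |swirl (v t) x - swirl (v t₀) (z • eZ)| ≤
              C * ((‖x - z • eZ‖ + Real.sqrt (t₀ - t)) / L) ^ α * C₁)
    (hmax : ∀ (T : ℝ), 0 < T →
      ∀ (v : ℝ → EuclideanSpace ℝ (Fin 3) → EuclideanSpace ℝ (Fin 3))
        (p : ℝ → EuclideanSpace ℝ (Fin 3) → ℝ),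
        IsSuitableWeakSolutionOn (slab (EuclideanSpace ℝ (Fin 3)) (Ioo 0 T) isOpen_Ioo) 1 0 v p →
        IsLerayHopfOn T 1 0 (v 0) v → (∀ t ∈ Ioo 0 T, IsAxisymmetric (v t)) →
        (∃ C : ℝ, ∀ x, |swirl (v 0) x| ≤ C) →
          ∃ C : ℝ, ∀ t ∈ Ioo 0 T, ∀ᵐ x ∂volume, |swirl (v t) x| ≤ C) :
    LeiZhang2011_regularity_bmoStream :=
  LeiZhang2011_regularity_bmoStream_of_swirlStepU_of_weakMaxPrinciple
    (swirlStepU_of_holderAtAxis hHolder) hmax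

/-! ### For smooth data Theorem 1.1 suffices -/

/-- **Lei–Zhang 2011, Theorem 1.4 for smooth data from Theorem 1.1 alone**: the statement of
the named fact restricted to smooth data with all derivatives in `L²` (Tao's class; the datum of a
Leray–Hopf solution is weakly, hence classically, divergence free), from Theorem 1.1 in the form
`hHolder`
(`LeiZhang2011_regularity_bmoStream_smoothDatum_of_swirlStepU` and `swirlStepU_of_holderAtAxis`;
the suitability hypothesis of the named fact is not used). [cite: LeiZhang2011, Thms. 1.1, 1.4, Rem. 1.5 and §4 (arXiv pp. 3–4, 12–13)] -/
theorem LeiZhang2011_regularity_bmoStream_smoothDatum_of_holderAtAxis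
    (hHolder : ∀ (C₁ : ℝ) (K : ℝ≥0), ∃ α C : ℝ, 0 < α ∧
      ∀ (v : ℝ → EuclideanSpace ℝ (Fin 3) → EuclideanSpace ℝ (Fin 3)),
        IsBoundedWeakNSSolutionOn (Iio 0) isOpen_Iio 1 v → Continuous (uncurry v) →
        (∀ t < 0, IsAxisymmetric (v t)) → (∀ t < 0, ∀ x, |swirl (v t) x| ≤ C₁) →
        (∀ t < 0, ∃ Bt : EuclideanSpace ℝ (Fin 3) → EuclideanSpace ℝ (Fin 3),
          LocallyIntegrable Bt volume ∧ eBMOSeminormVec Bt ≤ K ∧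
          ∀ (φ : EuclideanSpace ℝ (Fin 3) → ℝ) (e : EuclideanSpace ℝ (Fin 3)),
            ContDiff ℝ 1 φ → HasCompactSupport φ →
              ∫ x, φ x * ⟪v t x, e⟫ = ∫ x, ⟪cross (Bt x) (gradient φ x), e⟫) →
        ∀ (z t₀ : ℝ), t₀ < 0 → ∀ L : ℝ, 0 < L → ∀ (x : EuclideanSpace ℝ (Fin 3)) (t : ℝ),
          ‖x - z • eZ‖ ≤ L / 2 → t₀ - (L / 2) ^ 2 ≤ t → t ≤ t₀ →
            |swirl (v t) x - swirl (v t₀) (z • eZ)| ≤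
              C * ((‖x - z • eZ‖ + Real.sqrt (t₀ - t)) / L) ^ α * C₁)
    {T : ℝ} (hT : 0 < T) {v : ℝ → EuclideanSpace ℝ (Fin 3) → EuclideanSpace ℝ (Fin 3)}
    (hLH : IsLerayHopfOn T 1 0 (v 0) v) (h0 : ContDiff ℝ (⊤ : ℕ∞) (v 0))
    (h0sob : ∀ n : ℕ, ∫⁻ x, ‖iteratedFDeriv ℝ n (v 0) x‖ₑ ^ 2 < ⊤)
    (haxi : ∀ t ∈ Ioo 0 T, IsAxisymmetric (v t)) (hΓ₀ : ∃ C : ℝ, ∀ x, |swirl (v 0) x| ≤ C)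
    (hB : ∃ (B : ℝ → EuclideanSpace ℝ (Fin 3) → EuclideanSpace ℝ (Fin 3)) (K : ℝ≥0),
      HasBMOStreamFunctionOn (Ioo 0 T) v B K) :
    ∃ w : ℝ → EuclideanSpace ℝ (Fin 3) → EuclideanSpace ℝ (Fin 3),
      IsSmoothSpaceTimeOn (Ioc 0 T) w ∧
        uncurry v =ᵐ[volume.restrict (Ioo 0 T ×ˢ univ)] uncurry w :=
  -- the smooth datum of a Leray–Hopf solution is weakly, hence classically, divergence free
  have h0div : VectorCalculus.IsDivFree (v 0) :=
    (hLH.isWeaklyDivFree_datum hT).isDivFree_of_contDiff (h0.of_le (by exact_mod_cast le_top))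
  LeiZhang2011_regularity_bmoStream_smoothDatum_of_swirlStepU (swirlStepU_of_holderAtAxis hHolder)
    hT hLH h0 h0div h0sob haxi hΓ₀ hB

end Reduction

end Literature.Analysis.FluidPDE
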